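import Literature.AlgebraicGeometry.Frobenioids.MotivatingExamplesSubProofs2
import Mathlib.NumberTheory.RamificationInertia.Basic
import HarnessLib

/-!
# Frobenioids I, §6 sub-DAG — discharges, part 3: split degrees (Thm. 6.4 (iv) L02/L04) and Thm. 6.4 (i) L08

Proof-only companion of `MotivatingExamplesSub.lean` (Mochizuki, *The geometry of Frobenioids I*,
Kyushu J. Math. **62** (2008), §6, Thm. 6.4 (iv), proof p. 116 l. 17–35 [cite: MochizukiFrdI2008,
Thm. 6.4 (iv) p.116]). Discharged here:
* `Thm64iv_L02_placesOver_le` — the fundamental identity `Σ_{w ∣ p} e_w f_w = [L : ℚ]` (Mathlib's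
  `Ideal.sum_ramification_inertia`) gives `#{w ∣ p} ≤ [L : ℚ]` with equality iff every `e_w = f_w = 1`
  ("`p_i` splits completely in `L_i` if and only if `deg(L_i, v_i) = [L_i : ℚ]`", p. 116 l. 21–23);
* `Thm64iv_L04_degreeEq_of` — T64iv/L04 from T64iv/L02 and T64iv/L03 (a residue-characteristic
  preserving bijection of finite places preserves the split degrees, hence — given a completely split
  prime on each side — the degrees `[L_i : ℚ]` and complete splitting; p. 116 l. 23–25);
* `Thm64i_L08_strictlyRational_data` (Thm. 6.4 (i) p. 115 l. 21–22: every place supports the zeros of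
  some `f ∈ L^×` and not its poles — `f = p` at `w ∣ p`, `f = 2` at archimedean places).
No statement of the paper is strengthened; nothing here bears on abc.
-/

noncomputable section

namespace Literature.AlgebraicGeometry.Frobenioids

open NumberField IsDedekindDomain Ideal

section SplitDegrees

variable {L : Type} [Field L] [NumberField L]

/-- The places over `p` correspond to the primes of `𝓞 L` over `(p)`: the image of `placesOver L p`
under `w ↦ 𝔭_w` is Mathlib's `primesOverFinset (p) (𝓞 L)` ("valuations … that lie over the same valuation of `ℚ`",
p. 116 l. 19). [cite: MochizukiFrdI2008, Thm. 6.4 (iv) p.116] -/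
theorem image_placesOver_eq {p : ℕ} (hp : p.Prime) :
    (fun w : FinitePlace L => w.maximalIdeal.asIdeal) '' placesOver L p =
      (IsDedekindDomain.primesOverFinset (span {(p : ℤ)}) (𝓞 L) : Set (Ideal (𝓞 L))) := by
  classical
  haveI : Fact p.Prime := ⟨hp⟩
  have hpb : span {(p : ℤ)} ≠ ⊥ := by simp [hp.ne_zero]
  ext P
  simp only [Set.mem_image]
  rw [Finset.mem_coe, IsDedekindDomain.mem_primesOverFinset_iff hpb]
  constructor
  · rintro ⟨w, hw, rfl⟩
    haveI := liesOver_residueChar w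
    have hw' : residueChar w = p := hw
    rw [hw'] at this
    exact ⟨w.maximalIdeal.isPrime, this⟩
  · rintro ⟨hP, hPo⟩
    haveI := hP
    haveI := hPo
    have hP0 : P ≠ ⊥ := Ideal.ne_bot_of_liesOver_of_ne_bot hpb P
    let v : HeightOneSpectrum (𝓞 L) := ⟨P, hP, hP0⟩
    refine ⟨FinitePlace.mk v, ?_, by rw [FinitePlace.maximalIdeal_mk]⟩
    haveI : (FinitePlace.mk v).maximalIdeal.asIdeal.LiesOver (span {(p : ℤ)}) := by
      rw [FinitePlace.maximalIdeal_mk]; exact hPo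
    exact residueChar_eq_of_liesOver hp _

/-- `#{w ∣ p}` (`deg(L, v)` of p. 116 l. 19) is the number of primes of `𝓞 L` over `(p)`. [cite: MochizukiFrdI2008, Thm. 6.4 (iv) p.116] -/
theorem ncard_placesOver_eq {p : ℕ} (hp : p.Prime) :
    (placesOver L p).ncard = (IsDedekindDomain.primesOverFinset (span {(p : ℤ)}) (𝓞 L)).card := by
  have hg : Function.Injective (fun w : FinitePlace L => w.maximalIdeal.asIdeal) :=
    fun w₁ w₂ h => FinitePlace.maximalIdeal_injective (HeightOneSpectrum.ext h)
  rw [← Set.ncard_image_of_injective _ hg, image_placesOver_eq hp, Set.ncard_coe_finset]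

/-- **The fundamental identity at `p`, indexed by places**: `Σ_{w ∣ p} e_w f_w = [L : ℚ]` (Mathlib's
`Ideal.sum_ramification_inertia` for `ℤ ⊆ 𝓞 L`; behind "`p_i` splits completely … iff `deg(L_i, v_i) = [L_i : ℚ]`",
p. 116 l. 21–23). [cite: MochizukiFrdI2008, Thm. 6.4 (iv) p.116] -/
theorem sum_placesOver_ef {p : ℕ} (hp : p.Prime) :
    ∑ P ∈ IsDedekindDomain.primesOverFinset (span {(p : ℤ)}) (𝓞 L),
        (span {(p : ℤ)}).ramificationIdx' P * (span {(p : ℤ)}).inertiaDeg' P = Module.finrank ℚ L := by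
  haveI : Fact p.Prime := ⟨hp⟩
  have hpb : span {(p : ℤ)} ≠ ⊥ := by simp [hp.ne_zero]
  exact Ideal.sum_ramification_inertia (𝓞 L) ℚ L hpb

/-- **T64iv/L02** — PROVED. [cite: MochizukiFrdI2008, Thm. 6.4 (iv) p.116] -/
theorem Thm64iv_L02_placesOver_le_holds : Thm64iv_L02_placesOver_le := by
  intro L _ _ p hp
  classical
  haveI : Fact p.Prime := ⟨hp⟩
  have hpb : span {(p : ℤ)} ≠ ⊥ := by simp [hp.ne_zero]
  set T := IsDedekindDomain.primesOverFinset (span {(p : ℤ)}) (𝓞 L) with hT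
  -- every term of the fundamental identity is `≥ 1`
  have hterm : ∀ P ∈ T, 1 ≤ (span {(p : ℤ)}).ramificationIdx' P * (span {(p : ℤ)}).inertiaDeg' P := by
    intro P hP
    rw [hT, IsDedekindDomain.mem_primesOverFinset_iff hpb] at hP
    obtain ⟨hPp, hPo⟩ := hP
    haveI := hPp
    haveI := hPo
    have hP0 : P ≠ ⊥ := Ideal.ne_bot_of_liesOver_of_ne_bot hpb P
    haveI : P.IsMaximal := hPp.isMaximal hP0
    rw [Ideal.ramificationIdx'_eq_ramificationIdx _ P hpb, Ideal.inertiaDeg'_eq_inertiaDeg _ P]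
    exact Nat.one_le_iff_ne_zero.mpr (mul_ne_zero (Ideal.ramificationIdx_pos P ℤ).ne'
      (Ideal.inertiaDeg_pos P ℤ).ne')
  have hsum := sum_placesOver_ef (L := L) hp
  have hcard : T.card ≤ Module.finrank ℚ L := by
    have := Finset.card_nsmul_le_sum T _ 1 hterm
    rw [smul_eq_mul, mul_one] at this
    exact this.trans hsum.le
  refine ⟨placesOver_finite (L := L) p, by rw [ncard_placesOver_eq hp]; exact hcard, ?_⟩
  rw [ncard_placesOver_eq hp, ← hT]
  constructor
  · -- equality ⟹ every `e_w = f_w = 1`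
    intro heq w hw
    have hw' : residueChar w = p := hw
    haveI := liesOver_residueChar w
    rw [hw'] at this
    have hmem : w.maximalIdeal.asIdeal ∈ T := by
      rw [hT, IsDedekindDomain.mem_primesOverFinset_iff hpb]
      exact ⟨w.maximalIdeal.isPrime, this⟩
    haveI : w.maximalIdeal.asIdeal.IsMaximal := w.maximalIdeal.isPrime.isMaximal w.maximalIdeal.ne_bot
    -- all terms equal `1`
    have hall : ∀ P ∈ T,
        (span {(p : ℤ)}).ramificationIdx' P * (span {(p : ℤ)}).inertiaDeg' P = 1 := by
      have hzero : ∑ P ∈ T,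
          ((span {(p : ℤ)}).ramificationIdx' P * (span {(p : ℤ)}).inertiaDeg' P - 1) = 0 := by
        have h1 : ∑ P ∈ T, ((span {(p : ℤ)}).ramificationIdx' P * (span {(p : ℤ)}).inertiaDeg' P) =
            ∑ P ∈ T, (((span {(p : ℤ)}).ramificationIdx' P * (span {(p : ℤ)}).inertiaDeg' P - 1) + 1) :=
          Finset.sum_congr rfl fun P hP => (Nat.sub_add_cancel (hterm P hP)).symm
        rw [Finset.sum_add_distrib, Finset.sum_const, smul_eq_mul, mul_one, hsum, ← heq] at h1
        omega
      intro P hP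
      have := Finset.sum_eq_zero_iff.mp hzero P hP
      have h1 := hterm P hP
      omega
    have h1 := hall _ hmem
    rw [Ideal.ramificationIdx'_eq_ramificationIdx _ _ hpb, Ideal.inertiaDeg'_eq_inertiaDeg _ _] at h1
    exact mul_eq_one.mp h1
  · -- every `e_w = f_w = 1` ⟹ equality
    intro h1
    have hall : ∀ P ∈ T, (span {(p : ℤ)}).ramificationIdx' P * (span {(p : ℤ)}).inertiaDeg' P = 1 := by
      intro P hP
      have hP' := hP
      rw [hT, IsDedekindDomain.mem_primesOverFinset_iff hpb] at hP'
      obtain ⟨hPp, hPo⟩ := hP'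
      haveI := hPp
      haveI := hPo
      have hP0 : P ≠ ⊥ := Ideal.ne_bot_of_liesOver_of_ne_bot hpb P
      haveI : P.IsMaximal := hPp.isMaximal hP0
      -- `P = 𝔭_w` for the place `w` of `P`
      have hPim : P ∈ (fun w : FinitePlace L => w.maximalIdeal.asIdeal) '' placesOver L p := by
        rw [image_placesOver_eq hp]; exact hP
      obtain ⟨w, hw, rfl⟩ := hPim
      obtain ⟨he, hf⟩ := h1 w hw
      rw [Ideal.ramificationIdx'_eq_ramificationIdx _ _ hpb, Ideal.inertiaDeg'_eq_inertiaDeg _ _, he, hf]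
    rw [← hsum, Finset.sum_congr rfl hall, Finset.sum_const, smul_eq_mul, mul_one]

/-- **T64iv/L04 ⇐ T64iv/L02 + T64iv/L03** — PROVED: a bijection of finite places preserving the residue
characteristic preserves the numbers `deg(L_i, v_i)` of places over each `p`; with a completely split prime
on each side (T64iv/L03, "Tchebotarev" in print) the degrees `[L_i : ℚ]` agree and complete splitting is
preserved (p. 116 l. 23–25). [cite: MochizukiFrdI2008, Thm. 6.4 (iv) p.116] -/
theorem Thm64iv_L04_degreeEq_of (h3 : Thm64iv_L03_existsSplitPrime) : Thm64iv_L04_degreeEq := by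
  intro L₁ _ _ L₂ _ _ π hπ
  -- fibrewise bijection
  have hcount : ∀ p, (placesOver L₁ p).ncard = (placesOver L₂ p).ncard := by
    intro p
    have himg : π '' placesOver L₁ p = placesOver L₂ p := by
      ext w₂
      simp only [Set.mem_image, placesOver, Set.mem_setOf_eq]
      constructor
      · rintro ⟨w₁, hw₁, rfl⟩; rw [hπ]; exact hw₁
      · intro hw₂; exact ⟨π.symm w₂, by rw [← hπ, π.apply_symm_apply]; exact hw₂, π.apply_symm_apply w₂⟩
    rw [← himg, Set.ncard_image_of_injective _ π.injective]
  -- degrees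
  have hdeg : Module.finrank ℚ L₁ = Module.finrank ℚ L₂ := by
    obtain ⟨p₁, hp₁, hs₁⟩ := h3 L₁
    obtain ⟨p₂, hp₂, hs₂⟩ := h3 L₂
    have h12 := (Thm64iv_L02_placesOver_le_holds L₂ p₁ hp₁).2.1
    have h21 := (Thm64iv_L02_placesOver_le_holds L₁ p₂ hp₂).2.1
    rw [← hcount] at h12
    rw [hcount] at h21
    omega
  refine ⟨hcount, hdeg, fun p => ?_⟩
  simp only [SplitsCompletely, hcount p, hdeg]

/-! ### T64i/L08: every place is the support of a zero, outside the support of the poles, of some `f ∈ L^×` -/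

/-- **T64i/L08** — PROVED ("immediate from the definition of `B` that `C` is of [strictly] rational type",
p. 115 l. 21–22): at a finite place `w` over `p`, the element `p ∈ L^×` has `ord_w(p) > 0` and `ord_{w'}(p) ≥ 0`
everywhere (it is an algebraic integer); at an archimedean place, `|2|_v = 2 ≠ 1`.
[cite: MochizukiFrdI2008, Thm. 6.4 (i) p.115] -/
theorem Thm64i_L08_strictlyRational_data_holds : Thm64i_L08_strictlyRational_data := by
  intro L _ _
  refine ⟨fun w => ?_, fun v => ?_⟩
  · -- `f := p`, the rational prime below `w`
    have hp := residueChar_prime w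
    set p := residueChar w with hp_def
    have hp0 : algebraMap (𝓞 L) L (p : 𝓞 L) ≠ 0 :=
      (map_ne_zero_iff _ (IsFractionRing.injective (𝓞 L) L)).mpr (Nat.cast_ne_zero.mpr hp.ne_zero)
    let f : Lˣ := Units.mk0 _ hp0
    have hf : (f : L) = algebraMap (𝓞 L) L (p : 𝓞 L) := rfl
    -- `ord_{w'}(p)` read off the absolute value `|p|_{w'} = N(w')^{-ord}`
    have hN : ∀ w' : FinitePlace L, (1 : ℝ) < (Ideal.absNorm w'.maximalIdeal.asIdeal : ℝ) := fun w' => by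
      exact_mod_cast NumberField.HeightOneSpectrum.one_lt_absNorm w'.maximalIdeal
    refine ⟨f, ?_, fun w' _ => ?_⟩
    · -- `p ∈ 𝔭_w`, so `|p|_w < 1`, i.e. `ord_w(p) > 0`
      haveI := liesOver_residueChar w
      have hmem : (p : 𝓞 L) ∈ w.maximalIdeal.asIdeal := by
        have h : ((p : ℕ) : ℤ) ∈ span {((p : ℕ) : ℤ)} := Ideal.mem_span_singleton_self _
        rw [Ideal.LiesOver.over (p := span {((p : ℕ) : ℤ)}) (P := w.maximalIdeal.asIdeal),
          Ideal.mem_comap, map_natCast] at h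
        exact h
      have hlt : w (f : L) < 1 := by
        rw [hf, ← FinitePlace.norm_embedding_eq]
        exact (FinitePlace.norm_lt_one_iff_mem (K := L) w.maximalIdeal (p : 𝓞 L)).mpr hmem
      rw [apply_eq_absNorm_zpow, zpow_lt_one_iff_right₀ (hN w)] at hlt
      omega
    · -- `p` is an integer, so `|p|_{w'} ≤ 1`, i.e. `ord_{w'}(p) ≥ 0`
      have hle : w' (f : L) ≤ 1 := by
        rw [hf, ← FinitePlace.norm_embedding_eq]
        exact FinitePlace.norm_le_one (K := L) w'.maximalIdeal (p : 𝓞 L)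
      rw [apply_eq_absNorm_zpow, zpow_le_one_iff_right₀ (hN w')] at hle
      omega
  · -- `f := 2` at an archimedean place
    refine ⟨Units.mk0 (2 : L) two_ne_zero, ?_⟩
    have h2 : v ((Units.mk0 (2 : L) two_ne_zero : Lˣ) : L) = 2 := by
      rw [Units.val_mk0, ← InfinitePlace.mk_embedding v, InfinitePlace.apply, map_ofNat, Complex.norm_ofNat]
    rw [h2]
    exact (Real.log_pos one_lt_two).ne'

end SplitDegrees

end Literature.AlgebraicGeometry.Frobenioids

end
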